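import Summits.MatrixMultiplication.OmegaCensus.DominoPartThreeZ4Z4
import Summits.MatrixMultiplication.OmegaCensus.DihedralLawModOneNonCube
import HarnessLib

/-!
# The `|A| ≡ 1 (mod 3)` law over `A ↠ ℤ₄ × ℤ₄`: `|A| = 64, 208, 640, 928` (`ℤ₈²`, `ℤ₄ × ℤ₁₆`, `ℤ₄² × ℤ₁₃`, …)

ω-census `pub-omega`, family (b3), seat pub-omega-group gen 14.  Framing: lottery ticket; floor = certified bounds/negative
ranges.  VALUE: kernel theorems replacing the computational census cells NR58 (`|A| = 64`, cube shape `(1,3,7)` over `ℤ₈²`,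
`ℤ₄ × ℤ₁₆`) and NR65 (`|A| = 208`, shape `(1,3,23)` over `ℤ₄² × ℤ₁₃`); NOT progress on ω.

Assembly, exactly as in `DihedralLawModOneRankThree.lean` for `2`-rank `≥ 3`.  Let `G` be dihedral-like over `A` (any
`c₀`) with `φ : A →+ ZMod 4 × ZMod 4` onto, and let a TPP triple attain `3|S||T||U| + 8 = 8|A|`.
* `A` is never the union of two cosets of a cyclic subgroup (`not_two_cosets_of_onto_z4z4`: the image of two cosets in
  `ℤ₄²` has at most `8 < 16` elements).  Hence the shape is a cube `(c,c | d,d | e,e)` with `3cde + 1 = |A|`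
  (`two_cosets_of_mod_one_law_of_not_cube`) and has no two parts equal to `1` (`two_cosets_of_two_two_law`).
* If every factorisation `cde = (|A| − 1)/3` has two parts `1` or a part `1` next to a part `3` — this happens exactly when
  `(|A| − 1)/3 = 3p` with `p` prime, e.g. `21` (`|A| = 64`) and `69` (`|A| = 208`) — the remaining shapes are
  `(1,3,p)` up to order, excluded by `no_law_cube_13e_of_onto_z4z4` / `no_law_cube_1d3_of_onto_z4z4` and rotation.
Results: `no_mod_one_law_of_onto_z4z4` (general, factorisation property as hypothesis), `no_mod_one_law_card_64_of_onto_z4z4`,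
`no_mod_one_law_card_208_of_onto_z4z4`, and the instances `no_mod_one_law_z8_z8`, `no_mod_one_law_z4_z16`,
`no_mod_one_law_z4_z4_z13`, and (`(|A|−1)/3 = 213 = 3·71`, `309 = 3·103`) `no_mod_one_law_card_640/928_of_onto_z4z4` with
`no_mod_one_law_z4_z5_z32`, `no_mod_one_law_z5_z8_z16`, `no_mod_one_law_z4_z8_z29`: **no dihedral-like group over `ℤ₈²`, `ℤ₄ × ℤ₁₆`,
`ℤ₄² × ℤ₁₃`, `ℤ₄ × ℤ₅ × ℤ₃₂`, `ℤ₅ × ℤ₈ × ℤ₁₆` or `ℤ₄ × ℤ₈ × ℤ₂₉` (any `c₀`) has a TPP triple with `3|S||T||U| + 8 = 8|A|`** — the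
census lines `|A| = 64, 208, 640, 928` of the classification are complete kernel theorems.  With `no_law_card_64_of_rank_three` and the attaining cyclic-index-`2` groups
(`ℤ₆₄`, `ℤ₂ × ℤ₃₂`: `dihedral_law`, `c2_dihedral_law`), the order-`64` line of the classification 'law ⟺ `A` has an
element of order `≥ |A|/2`' is now a kernel theorem for all eleven abelian groups of order `64`.
-/

namespace Summit.MatrixMultiplication.OmegaCensus

open Finset

/-! ## Arithmetic: factorisations of `21` and `69` -/

section Arith

/-- `cde = 21`: two parts `1`, or a part `1` and a part `3`. [folklore] -/
theorem cube_factor_13_of_64 {c d e : ℕ} (h : 3 * (c * d * e) + 1 = 64) :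
    (c = 1 ∧ d = 1) ∨ (d = 1 ∧ e = 1) ∨ (c = 1 ∧ e = 1) ∨ (c = 1 ∧ d = 3) ∨ (c = 1 ∧ e = 3) ∨ (d = 1 ∧ c = 3) ∨
      (d = 1 ∧ e = 3) ∨ (e = 1 ∧ c = 3) ∨ (e = 1 ∧ d = 3) := by
  have hcde : c * (d * e) = 21 := by rw [← mul_assoc]; omega
  have hc : c ∈ Nat.divisors 21 := Nat.mem_divisors.2 ⟨Dvd.intro _ hcde, by norm_num⟩
  have hd : d ∈ Nat.divisors 21 :=
    Nat.mem_divisors.2 ⟨Dvd.intro (c * e) (by rw [← hcde]; ring), by norm_num⟩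
  rw [show Nat.divisors 21 = {1, 3, 7, 21} from by decide] at hc hd
  simp only [Finset.mem_insert, Finset.mem_singleton] at hc hd
  rcases hc with rfl | rfl | rfl | rfl <;> rcases hd with rfl | rfl | rfl | rfl <;> omega

/-- `cde = 69`: two parts `1`, or a part `1` and a part `3`. [folklore] -/
theorem cube_factor_13_of_208 {c d e : ℕ} (h : 3 * (c * d * e) + 1 = 208) :
    (c = 1 ∧ d = 1) ∨ (d = 1 ∧ e = 1) ∨ (c = 1 ∧ e = 1) ∨ (c = 1 ∧ d = 3) ∨ (c = 1 ∧ e = 3) ∨ (d = 1 ∧ c = 3) ∨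
      (d = 1 ∧ e = 3) ∨ (e = 1 ∧ c = 3) ∨ (e = 1 ∧ d = 3) := by
  have hcde : c * (d * e) = 69 := by rw [← mul_assoc]; omega
  have hc : c ∈ Nat.divisors 69 := Nat.mem_divisors.2 ⟨Dvd.intro _ hcde, by norm_num⟩
  have hd : d ∈ Nat.divisors 69 :=
    Nat.mem_divisors.2 ⟨Dvd.intro (c * e) (by rw [← hcde]; ring), by norm_num⟩
  rw [show Nat.divisors 69 = {1, 3, 23, 69} from by decide] at hc hd
  simp only [Finset.mem_insert, Finset.mem_singleton] at hc hd
  rcases hc with rfl | rfl | rfl | rfl <;> rcases hd with rfl | rfl | rfl | rfl <;> omega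

/-- `cde = 213 = 3·71` (`|A| = 640`): two parts `1`, or a part `1` and a part `3`. [folklore] -/
theorem cube_factor_13_of_640 {c d e : ℕ} (h : 3 * (c * d * e) + 1 = 640) :
    (c = 1 ∧ d = 1) ∨ (d = 1 ∧ e = 1) ∨ (c = 1 ∧ e = 1) ∨ (c = 1 ∧ d = 3) ∨ (c = 1 ∧ e = 3) ∨ (d = 1 ∧ c = 3) ∨
      (d = 1 ∧ e = 3) ∨ (e = 1 ∧ c = 3) ∨ (e = 1 ∧ d = 3) := by
  have hcde : c * (d * e) = 213 := by rw [← mul_assoc]; omega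
  have hc : c ∈ Nat.divisors 213 := Nat.mem_divisors.2 ⟨Dvd.intro _ hcde, by norm_num⟩
  have hd : d ∈ Nat.divisors 213 :=
    Nat.mem_divisors.2 ⟨Dvd.intro (c * e) (by rw [← hcde]; ring), by norm_num⟩
  rw [show Nat.divisors 213 = {1, 3, 71, 213} from by decide] at hc hd
  simp only [Finset.mem_insert, Finset.mem_singleton] at hc hd
  rcases hc with rfl | rfl | rfl | rfl <;> rcases hd with rfl | rfl | rfl | rfl <;> omega

/-- `cde = 309 = 3·103` (`|A| = 928`): two parts `1`, or a part `1` and a part `3`. [folklore] -/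
theorem cube_factor_13_of_928 {c d e : ℕ} (h : 3 * (c * d * e) + 1 = 928) :
    (c = 1 ∧ d = 1) ∨ (d = 1 ∧ e = 1) ∨ (c = 1 ∧ e = 1) ∨ (c = 1 ∧ d = 3) ∨ (c = 1 ∧ e = 3) ∨ (d = 1 ∧ c = 3) ∨
      (d = 1 ∧ e = 3) ∨ (e = 1 ∧ c = 3) ∨ (e = 1 ∧ d = 3) := by
  have hcde : c * (d * e) = 309 := by rw [← mul_assoc]; omega
  have hc : c ∈ Nat.divisors 309 := Nat.mem_divisors.2 ⟨Dvd.intro _ hcde, by norm_num⟩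
  have hd : d ∈ Nat.divisors 309 :=
    Nat.mem_divisors.2 ⟨Dvd.intro (c * e) (by rw [← hcde]; ring), by norm_num⟩
  rw [show Nat.divisors 309 = {1, 3, 103, 309} from by decide] at hc hd
  simp only [Finset.mem_insert, Finset.mem_singleton] at hc hd
  rcases hc with rfl | rfl | rfl | rfl <;> rcases hd with rfl | rfl | rfl | rfl <;> omega

end Arith

/-! ## Groups mapping onto `ℤ₄ × ℤ₄` are not two cosets of a cyclic subgroup -/

section TwoCosets

variable {A : Type*} [AddCommGroup A]

/-- If `A ↠ ZMod 4 × ZMod 4` then `A` is not the union of two cosets of a cyclic subgroup (the image of `⟨g⟩` has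
at most `4` elements, and `16 > 2 · 4`). [folklore] -/
theorem not_two_cosets_of_onto_z4z4 (φ : A →+ ZMod 4 × ZMod 4) (hφ : Function.Surjective φ) (g a b : A) :
    ¬ ∀ x : A, x - a ∈ AddSubgroup.zmultiples g ∨ x - b ∈ AddSubgroup.zmultiples g := by
  intro h
  have hQ : ∀ q : ZMod 4 × ZMod 4, q - φ a ∈ AddSubgroup.zmultiples (φ g) ∨
      q - φ b ∈ AddSubgroup.zmultiples (φ g) := by
    intro q
    obtain ⟨x, rfl⟩ := hφ q
    rcases h x with hx | hx
    · left
      obtain ⟨k, hk⟩ := AddSubgroup.mem_zmultiples_iff.1 hx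
      exact AddSubgroup.mem_zmultiples_iff.2 ⟨k, by rw [← map_zsmul, hk, map_sub]⟩
    · right
      obtain ⟨k, hk⟩ := AddSubgroup.mem_zmultiples_iff.1 hx
      exact AddSubgroup.mem_zmultiples_iff.2 ⟨k, by rw [← map_zsmul, hk, map_sub]⟩
  have hle := card_le_two_mul_addOrderOf_of_two_cosets hQ
  have h4 : addOrderOf (φ g) ∣ 4 := addOrderOf_dvd_of_nsmul_eq_zero (by
    have : ∀ q : ZMod 4 × ZMod 4, 4 • q = 0 := by decide
    exact this _)
  have h4' := Nat.le_of_dvd (by norm_num) h4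
  have hcard : Fintype.card (ZMod 4 × ZMod 4) = 16 := by simp
  omega

end TwoCosets

/-! ## Assembly -/

section DihedralLike

variable {A : Type} [AddCommGroup A] [DecidableEq A] [Fintype A] {G : Type} [Group G] [DecidableEq G]
  {ρ τ : A → G} {c₀ : A} {S T U : Finset G}

open Literature.Combinatorics.Additive

/-- **No `|A| ≡ 1 (mod 3)` law over `A ↠ ℤ₄ × ℤ₄`, under the factorisation property** (every `cde = (|A| − 1)/3` has two
parts `1` or a part `1` next to a part `3`): for every TPP triple of a dihedral-like group over `A` (any `c₀`),
`3|S||T||U| + 8 ≠ 8|A|`. [folklore] -/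
theorem no_mod_one_law_of_onto_z4z4
    (hρρ : ∀ a b, ρ a * ρ b = ρ (a + b)) (hρτ : ∀ a b, ρ a * τ b = τ (b - a))
    (hτρ : ∀ a b, τ a * ρ b = τ (a + b)) (hττ : ∀ a b, τ a * τ b = ρ (c₀ + b - a))
    (hρ : Function.Injective ρ) (hτ : Function.Injective τ) (hne : ∀ a b, ρ a ≠ τ b)
    (hsurj : ∀ g, (∃ a, ρ a = g) ∨ (∃ a, τ a = g)) (hA : 14 ≤ Fintype.card A)
    (φ : A →+ ZMod 4 × ZMod 4) (hφ : Function.Surjective φ)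
    (hq : ∀ c d e : ℕ, 3 * (c * d * e) + 1 = Fintype.card A →
      (c = 1 ∧ d = 1) ∨ (d = 1 ∧ e = 1) ∨ (c = 1 ∧ e = 1) ∨ (c = 1 ∧ d = 3) ∨ (c = 1 ∧ e = 3) ∨ (d = 1 ∧ c = 3) ∨
        (d = 1 ∧ e = 3) ∨ (e = 1 ∧ c = 3) ∨ (e = 1 ∧ d = 3))
    (h : TripleProductProperty S T U) : 3 * (S.card * T.card * U.card) + 8 ≠ 8 * Fintype.card A := by
  intro hV
  have hmod : Fintype.card A % 3 = 1 := by omega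
  have hA7 : 7 ≤ Fintype.card A := by omega
  have hV_TUS : 3 * (T.card * U.card * S.card) + 8 = 8 * Fintype.card A := by
    rw [show T.card * U.card * S.card = S.card * T.card * U.card by ring]; exact hV
  have hV_UST : 3 * (U.card * S.card * T.card) + 8 = 8 * Fintype.card A := by
    rw [show U.card * S.card * T.card = S.card * T.card * U.card by ring]; exact hV
  have hTUS : TripleProductProperty T U S := h.rotate
  have hUST : TripleProductProperty U S T := h.rotate.rotate
  by_cases hnc : ((univ.filter fun a : A => ρ a ∈ S).card = (univ.filter fun a : A => τ a ∈ S).card ∧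
      (univ.filter fun a : A => ρ a ∈ T).card = (univ.filter fun a : A => τ a ∈ T).card ∧
      (univ.filter fun a : A => ρ a ∈ U).card = (univ.filter fun a : A => τ a ∈ U).card)
  · obtain ⟨hS', hT', hU'⟩ := hnc
    have cS := card_eq_parts' hρ hτ hne hsurj S
    have cT := card_eq_parts' hρ hτ hne hsurj T
    have cU := card_eq_parts' hρ hτ hne hsurj U
    set s₀ := (univ.filter fun a : A => ρ a ∈ S).card with hs₀
    set t₀ := (univ.filter fun a : A => ρ a ∈ T).card with ht₀
    set u₀ := (univ.filter fun a : A => ρ a ∈ U).card with hu₀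
    have eS : S.card = 2 * s₀ := by rw [cS, ← hS']; ring
    have eT : T.card = 2 * t₀ := by rw [cT, ← hT']; ring
    have eU : U.card = 2 * u₀ := by rw [cU, ← hU']; ring
    have hprod : 3 * (s₀ * t₀ * u₀) + 1 = Fintype.card A := by
      rw [eS, eT, eU] at hV; nlinarith
    rcases hq s₀ t₀ u₀ hprod with ⟨h1, h1'⟩ | ⟨h1, h1'⟩ | ⟨h1, h1'⟩ | ⟨h1, h1'⟩ | ⟨h1, h1'⟩ | ⟨h1, h1'⟩ |
        ⟨h1, h1'⟩ | ⟨h1, h1'⟩ | ⟨h1, h1'⟩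
    · obtain ⟨g, a, b, hab⟩ := two_cosets_of_two_two_law hρρ hρτ hτρ hττ hρ hτ hne hsurj hmod hA7 h
        (by rw [eS, h1]) (by rw [eT, h1']) hV
      exact not_two_cosets_of_onto_z4z4 φ hφ g a b hab
    · obtain ⟨g, a, b, hab⟩ := two_cosets_of_two_two_law hρρ hρτ hτρ hττ hρ hτ hne hsurj hmod hA7 hTUS
        (by rw [eT, h1]) (by rw [eU, h1']) hV_TUS
      exact not_two_cosets_of_onto_z4z4 φ hφ g a b hab
    · obtain ⟨g, a, b, hab⟩ := two_cosets_of_two_two_law hρρ hρτ hτρ hττ hρ hτ hne hsurj hmod hA7 hUST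
        (by rw [eU, h1']) (by rw [eS, h1]) hV_UST
      exact not_two_cosets_of_onto_z4z4 φ hφ g a b hab
    -- `(1,3,e)` and `(1,e,3)` in the six arrangements
    · exact no_law_cube_13e_of_onto_z4z4 hρρ hρτ hτρ hττ hρ hτ hne hsurj φ hφ h h1 (hS' ▸ h1) h1' (hT' ▸ h1')
        hU' hV
    · exact no_law_cube_1d3_of_onto_z4z4 hρρ hρτ hτρ hττ hρ hτ hne hsurj φ hφ h h1 (hS' ▸ h1) hT' h1'
        (hU' ▸ h1') hV
    · exact no_law_cube_1d3_of_onto_z4z4 hρρ hρτ hτρ hττ hρ hτ hne hsurj φ hφ hTUS h1 (hT' ▸ h1) hU' h1'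
        (hS' ▸ h1') hV_TUS
    · exact no_law_cube_13e_of_onto_z4z4 hρρ hρτ hτρ hττ hρ hτ hne hsurj φ hφ hTUS h1 (hT' ▸ h1) h1' (hU' ▸ h1')
        hS' hV_TUS
    · exact no_law_cube_13e_of_onto_z4z4 hρρ hρτ hτρ hττ hρ hτ hne hsurj φ hφ hUST h1 (hU' ▸ h1) h1' (hS' ▸ h1')
        hT' hV_UST
    · exact no_law_cube_1d3_of_onto_z4z4 hρρ hρτ hτρ hττ hρ hτ hne hsurj φ hφ hUST h1 (hU' ▸ h1) hS' h1'
        (hT' ▸ h1') hV_UST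
  · obtain ⟨g, a, b, hab⟩ :=
      two_cosets_of_mod_one_law_of_not_cube hρρ hρτ hτρ hττ hρ hτ hne hsurj hmod hA h hV hnc
    exact not_two_cosets_of_onto_z4z4 φ hφ g a b hab

/-- **`|A| = 64`, `A ↠ ℤ₄ × ℤ₄` (`ℤ₈²`, `ℤ₄ × ℤ₁₆`, and the `2`-rank-`≥ 3` groups `ℤ₄³`, `ℤ₂² × ℤ₄²`, `ℤ₂ × ℤ₄ × ℤ₈`):
no dihedral-like group over `A` (any `c₀`) attains `3|S||T||U| + 8 = 8|A|`.** [folklore] -/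
theorem no_mod_one_law_card_64_of_onto_z4z4
    (hρρ : ∀ a b, ρ a * ρ b = ρ (a + b)) (hρτ : ∀ a b, ρ a * τ b = τ (b - a))
    (hτρ : ∀ a b, τ a * ρ b = τ (a + b)) (hττ : ∀ a b, τ a * τ b = ρ (c₀ + b - a))
    (hρ : Function.Injective ρ) (hτ : Function.Injective τ) (hne : ∀ a b, ρ a ≠ τ b)
    (hsurj : ∀ g, (∃ a, ρ a = g) ∨ (∃ a, τ a = g)) (hA : Fintype.card A = 64)
    (φ : A →+ ZMod 4 × ZMod 4) (hφ : Function.Surjective φ) (h : TripleProductProperty S T U) :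
    3 * (S.card * T.card * U.card) + 8 ≠ 8 * Fintype.card A :=
  no_mod_one_law_of_onto_z4z4 hρρ hρτ hτρ hττ hρ hτ hne hsurj (by rw [hA]; norm_num) φ hφ
    (fun c d e hcde => cube_factor_13_of_64 (by rw [hcde, hA])) h

/-- **`|A| = 208`, `A ↠ ℤ₄ × ℤ₄` (`ℤ₄² × ℤ₁₃`, and `ℤ₂² × ℤ₄ × ℤ₁₃` of `2`-rank `3`): no dihedral-like group over `A`
(any `c₀`) attains `3|S||T||U| + 8 = 8|A|`.** [folklore] -/
theorem no_mod_one_law_card_208_of_onto_z4z4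
    (hρρ : ∀ a b, ρ a * ρ b = ρ (a + b)) (hρτ : ∀ a b, ρ a * τ b = τ (b - a))
    (hτρ : ∀ a b, τ a * ρ b = τ (a + b)) (hττ : ∀ a b, τ a * τ b = ρ (c₀ + b - a))
    (hρ : Function.Injective ρ) (hτ : Function.Injective τ) (hne : ∀ a b, ρ a ≠ τ b)
    (hsurj : ∀ g, (∃ a, ρ a = g) ∨ (∃ a, τ a = g)) (hA : Fintype.card A = 208)
    (φ : A →+ ZMod 4 × ZMod 4) (hφ : Function.Surjective φ) (h : TripleProductProperty S T U) :
    3 * (S.card * T.card * U.card) + 8 ≠ 8 * Fintype.card A :=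
  no_mod_one_law_of_onto_z4z4 hρρ hρτ hτρ hττ hρ hτ hne hsurj (by rw [hA]; norm_num) φ hφ
    (fun c d e hcde => cube_factor_13_of_208 (by rw [hcde, hA])) h

/-- **`|A| = 640`, `A ↠ ℤ₄ × ℤ₄` (`ℤ₄ × ℤ₅ × ℤ₃₂`, `ℤ₅ × ℤ₈ × ℤ₁₆`, …): no dihedral-like group over `A` (any `c₀`) attains
`3|S||T||U| + 8 = 8|A|`** (`(|A|−1)/3 = 213 = 3·71`). [folklore] -/
theorem no_mod_one_law_card_640_of_onto_z4z4
    (hρρ : ∀ a b, ρ a * ρ b = ρ (a + b)) (hρτ : ∀ a b, ρ a * τ b = τ (b - a))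
    (hτρ : ∀ a b, τ a * ρ b = τ (a + b)) (hττ : ∀ a b, τ a * τ b = ρ (c₀ + b - a))
    (hρ : Function.Injective ρ) (hτ : Function.Injective τ) (hne : ∀ a b, ρ a ≠ τ b)
    (hsurj : ∀ g, (∃ a, ρ a = g) ∨ (∃ a, τ a = g)) (hA : Fintype.card A = 640)
    (φ : A →+ ZMod 4 × ZMod 4) (hφ : Function.Surjective φ) (h : TripleProductProperty S T U) :
    3 * (S.card * T.card * U.card) + 8 ≠ 8 * Fintype.card A :=
  no_mod_one_law_of_onto_z4z4 hρρ hρτ hτρ hττ hρ hτ hne hsurj (by rw [hA]; norm_num) φ hφ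
    (fun c d e hcde => cube_factor_13_of_640 (by rw [hcde, hA])) h

/-- **`|A| = 928`, `A ↠ ℤ₄ × ℤ₄` (`ℤ₄ × ℤ₈ × ℤ₂₉`, …): no dihedral-like group over `A` (any `c₀`) attains
`3|S||T||U| + 8 = 8|A|`** (`(|A|−1)/3 = 309 = 3·103`). [folklore] -/
theorem no_mod_one_law_card_928_of_onto_z4z4
    (hρρ : ∀ a b, ρ a * ρ b = ρ (a + b)) (hρτ : ∀ a b, ρ a * τ b = τ (b - a))
    (hτρ : ∀ a b, τ a * ρ b = τ (a + b)) (hττ : ∀ a b, τ a * τ b = ρ (c₀ + b - a))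
    (hρ : Function.Injective ρ) (hτ : Function.Injective τ) (hne : ∀ a b, ρ a ≠ τ b)
    (hsurj : ∀ g, (∃ a, ρ a = g) ∨ (∃ a, τ a = g)) (hA : Fintype.card A = 928)
    (φ : A →+ ZMod 4 × ZMod 4) (hφ : Function.Surjective φ) (h : TripleProductProperty S T U) :
    3 * (S.card * T.card * U.card) + 8 ≠ 8 * Fintype.card A :=
  no_mod_one_law_of_onto_z4z4 hρρ hρτ hτρ hττ hρ hτ hne hsurj (by rw [hA]; norm_num) φ hφ
    (fun c d e hcde => cube_factor_13_of_928 (by rw [hcde, hA])) h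

end DihedralLike

/-! ## Instances: `ℤ₈ × ℤ₈`, `ℤ₄ × ℤ₁₆`, `ℤ₄ × ℤ₄ × ℤ₁₃` -/

section Instances

variable {G : Type} [Group G] [DecidableEq G] {S T U : Finset G}

open Literature.Combinatorics.Additive

/-- The reduction `ℤ₈ × ℤ₈ ↠ ℤ₄ × ℤ₄`. [folklore] -/
theorem z8_z8_onto_z4z4 : Function.Surjective
    ((ZMod.castHom (show 4 ∣ 8 by norm_num) (ZMod 4)).toAddMonoidHom.prodMap
      (ZMod.castHom (show 4 ∣ 8 by norm_num) (ZMod 4)).toAddMonoidHom : ZMod 8 × ZMod 8 →+ ZMod 4 × ZMod 4) := by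
  intro q
  obtain ⟨a, ha⟩ := ZMod.castHom_surjective (show 4 ∣ 8 by norm_num) (n := 8) q.1
  obtain ⟨b, hb⟩ := ZMod.castHom_surjective (show 4 ∣ 8 by norm_num) (n := 8) q.2
  exact ⟨(a, b), Prod.ext ha hb⟩

/-- The reduction `ℤ₄ × ℤ₁₆ ↠ ℤ₄ × ℤ₄`. [folklore] -/
theorem z4_z16_onto_z4z4 : Function.Surjective
    ((AddMonoidHom.id (ZMod 4)).prodMap
      (ZMod.castHom (show 4 ∣ 16 by norm_num) (ZMod 4)).toAddMonoidHom : ZMod 4 × ZMod 16 →+ ZMod 4 × ZMod 4) := by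
  intro q
  obtain ⟨b, hb⟩ := ZMod.castHom_surjective (show 4 ∣ 16 by norm_num) (n := 16) q.2
  exact ⟨(q.1, b), Prod.ext rfl hb⟩

/-- The projection `ℤ₄ × ℤ₄ × ℤ₁₃ ↠ ℤ₄ × ℤ₄`. [folklore] -/
theorem z4_z4_z13_onto_z4z4 : Function.Surjective
    ((AddMonoidHom.id (ZMod 4)).prodMap (AddMonoidHom.fst (ZMod 4) (ZMod 13)) :
      ZMod 4 × (ZMod 4 × ZMod 13) →+ ZMod 4 × ZMod 4) :=
  fun q => ⟨(q.1, (q.2, 0)), Prod.ext rfl rfl⟩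

/-- **`ℤ₈ × ℤ₈`: no dihedral-like group over it (any `c₀`; for `c₀ = 0` this is `Dih(ℤ₈²)`) has a TPP triple with
`3|S||T||U| + 8 = 8 · 64`** — the census cell NR58 as a kernel theorem. [folklore] -/
theorem no_mod_one_law_z8_z8 {ρ τ : ZMod 8 × ZMod 8 → G} {c₀ : ZMod 8 × ZMod 8}
    (hρρ : ∀ a b, ρ a * ρ b = ρ (a + b)) (hρτ : ∀ a b, ρ a * τ b = τ (b - a))
    (hτρ : ∀ a b, τ a * ρ b = τ (a + b)) (hττ : ∀ a b, τ a * τ b = ρ (c₀ + b - a))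
    (hρ : Function.Injective ρ) (hτ : Function.Injective τ) (hne : ∀ a b, ρ a ≠ τ b)
    (hsurj : ∀ g, (∃ a, ρ a = g) ∨ (∃ a, τ a = g)) (h : TripleProductProperty S T U) :
    3 * (S.card * T.card * U.card) + 8 ≠ 8 * Fintype.card (ZMod 8 × ZMod 8) :=
  no_mod_one_law_card_64_of_onto_z4z4 hρρ hρτ hτρ hττ hρ hτ hne hsurj (by simp) _ z8_z8_onto_z4z4 h

/-- **`ℤ₄ × ℤ₁₆`: no dihedral-like group over it (any `c₀`) has a TPP triple with `3|S||T||U| + 8 = 8 · 64`** — the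
second NR58 cell as a kernel theorem. [folklore] -/
theorem no_mod_one_law_z4_z16 {ρ τ : ZMod 4 × ZMod 16 → G} {c₀ : ZMod 4 × ZMod 16}
    (hρρ : ∀ a b, ρ a * ρ b = ρ (a + b)) (hρτ : ∀ a b, ρ a * τ b = τ (b - a))
    (hτρ : ∀ a b, τ a * ρ b = τ (a + b)) (hττ : ∀ a b, τ a * τ b = ρ (c₀ + b - a))
    (hρ : Function.Injective ρ) (hτ : Function.Injective τ) (hne : ∀ a b, ρ a ≠ τ b)
    (hsurj : ∀ g, (∃ a, ρ a = g) ∨ (∃ a, τ a = g)) (h : TripleProductProperty S T U) :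
    3 * (S.card * T.card * U.card) + 8 ≠ 8 * Fintype.card (ZMod 4 × ZMod 16) :=
  no_mod_one_law_card_64_of_onto_z4z4 hρρ hρτ hτρ hττ hρ hτ hne hsurj (by simp) _ z4_z16_onto_z4z4 h

/-- **`ℤ₄ × ℤ₄ × ℤ₁₃`: no dihedral-like group over it (any `c₀`) has a TPP triple with `3|S||T||U| + 8 = 8 · 208`** —
the census cell NR65 as a kernel theorem. [folklore] -/
theorem no_mod_one_law_z4_z4_z13 {ρ τ : ZMod 4 × (ZMod 4 × ZMod 13) → G} {c₀ : ZMod 4 × (ZMod 4 × ZMod 13)}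
    (hρρ : ∀ a b, ρ a * ρ b = ρ (a + b)) (hρτ : ∀ a b, ρ a * τ b = τ (b - a))
    (hτρ : ∀ a b, τ a * ρ b = τ (a + b)) (hττ : ∀ a b, τ a * τ b = ρ (c₀ + b - a))
    (hρ : Function.Injective ρ) (hτ : Function.Injective τ) (hne : ∀ a b, ρ a ≠ τ b)
    (hsurj : ∀ g, (∃ a, ρ a = g) ∨ (∃ a, τ a = g)) (h : TripleProductProperty S T U) :
    3 * (S.card * T.card * U.card) + 8 ≠ 8 * Fintype.card (ZMod 4 × (ZMod 4 × ZMod 13)) :=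
  no_mod_one_law_card_208_of_onto_z4z4 hρρ hρτ hτρ hττ hρ hτ hne hsurj (by simp) _ z4_z4_z13_onto_z4z4 h

/-- **`ℤ₄ × ℤ₅ × ℤ₃₂` (`|A| = 640`): no dihedral-like group over it (any `c₀`) has a TPP triple with `3|S||T||U| + 8 = 8|A|`.**
[folklore] -/
theorem no_mod_one_law_z4_z5_z32 {ρ τ : ZMod 4 × (ZMod 5 × ZMod 32) → G} {c₀ : ZMod 4 × (ZMod 5 × ZMod 32)}
    (hρρ : ∀ a b, ρ a * ρ b = ρ (a + b)) (hρτ : ∀ a b, ρ a * τ b = τ (b - a))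
    (hτρ : ∀ a b, τ a * ρ b = τ (a + b)) (hττ : ∀ a b, τ a * τ b = ρ (c₀ + b - a))
    (hρ : Function.Injective ρ) (hτ : Function.Injective τ) (hne : ∀ a b, ρ a ≠ τ b)
    (hsurj : ∀ g, (∃ a, ρ a = g) ∨ (∃ a, τ a = g)) (h : TripleProductProperty S T U) :
    3 * (S.card * T.card * U.card) + 8 ≠ 8 * Fintype.card (ZMod 4 × (ZMod 5 × ZMod 32)) := by
  refine no_mod_one_law_card_640_of_onto_z4z4 hρρ hρτ hτρ hττ hρ hτ hne hsurj (by simp)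
    ((AddMonoidHom.id (ZMod 4)).prodMap
      ((ZMod.castHom (show 4 ∣ 32 by norm_num) (ZMod 4)).toAddMonoidHom.comp
        (AddMonoidHom.snd (ZMod 5) (ZMod 32)))) ?_ h
  intro q
  obtain ⟨b, hb⟩ := ZMod.castHom_surjective (show 4 ∣ 32 by norm_num) (n := 32) q.2
  exact ⟨(q.1, (0, b)), Prod.ext rfl hb⟩

/-- **`ℤ₅ × ℤ₈ × ℤ₁₆` (`|A| = 640`): no dihedral-like group over it (any `c₀`) has a TPP triple with `3|S||T||U| + 8 = 8|A|`.**
[folklore] -/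
theorem no_mod_one_law_z5_z8_z16 {ρ τ : ZMod 5 × (ZMod 8 × ZMod 16) → G} {c₀ : ZMod 5 × (ZMod 8 × ZMod 16)}
    (hρρ : ∀ a b, ρ a * ρ b = ρ (a + b)) (hρτ : ∀ a b, ρ a * τ b = τ (b - a))
    (hτρ : ∀ a b, τ a * ρ b = τ (a + b)) (hττ : ∀ a b, τ a * τ b = ρ (c₀ + b - a))
    (hρ : Function.Injective ρ) (hτ : Function.Injective τ) (hne : ∀ a b, ρ a ≠ τ b)
    (hsurj : ∀ g, (∃ a, ρ a = g) ∨ (∃ a, τ a = g)) (h : TripleProductProperty S T U) :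
    3 * (S.card * T.card * U.card) + 8 ≠ 8 * Fintype.card (ZMod 5 × (ZMod 8 × ZMod 16)) := by
  refine no_mod_one_law_card_640_of_onto_z4z4 hρρ hρτ hτρ hττ hρ hτ hne hsurj (by simp)
    (((ZMod.castHom (show 4 ∣ 8 by norm_num) (ZMod 4)).toAddMonoidHom.prodMap
      (ZMod.castHom (show 4 ∣ 16 by norm_num) (ZMod 4)).toAddMonoidHom).comp
      (AddMonoidHom.snd (ZMod 5) (ZMod 8 × ZMod 16))) ?_ h
  intro q
  obtain ⟨a, ha⟩ := ZMod.castHom_surjective (show 4 ∣ 8 by norm_num) (n := 8) q.1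
  obtain ⟨b, hb⟩ := ZMod.castHom_surjective (show 4 ∣ 16 by norm_num) (n := 16) q.2
  exact ⟨(0, (a, b)), Prod.ext ha hb⟩

/-- **`ℤ₄ × ℤ₈ × ℤ₂₉` (`|A| = 928`): no dihedral-like group over it (any `c₀`) has a TPP triple with `3|S||T||U| + 8 = 8|A|`.**
[folklore] -/
theorem no_mod_one_law_z4_z8_z29 {ρ τ : ZMod 4 × (ZMod 8 × ZMod 29) → G} {c₀ : ZMod 4 × (ZMod 8 × ZMod 29)}
    (hρρ : ∀ a b, ρ a * ρ b = ρ (a + b)) (hρτ : ∀ a b, ρ a * τ b = τ (b - a))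
    (hτρ : ∀ a b, τ a * ρ b = τ (a + b)) (hττ : ∀ a b, τ a * τ b = ρ (c₀ + b - a))
    (hρ : Function.Injective ρ) (hτ : Function.Injective τ) (hne : ∀ a b, ρ a ≠ τ b)
    (hsurj : ∀ g, (∃ a, ρ a = g) ∨ (∃ a, τ a = g)) (h : TripleProductProperty S T U) :
    3 * (S.card * T.card * U.card) + 8 ≠ 8 * Fintype.card (ZMod 4 × (ZMod 8 × ZMod 29)) := by
  refine no_mod_one_law_card_928_of_onto_z4z4 hρρ hρτ hτρ hττ hρ hτ hne hsurj (by simp)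
    ((AddMonoidHom.id (ZMod 4)).prodMap
      ((ZMod.castHom (show 4 ∣ 8 by norm_num) (ZMod 4)).toAddMonoidHom.comp
        (AddMonoidHom.fst (ZMod 8) (ZMod 29)))) ?_ h
  intro q
  obtain ⟨b, hb⟩ := ZMod.castHom_surjective (show 4 ∣ 8 by norm_num) (n := 8) q.2
  exact ⟨(q.1, (b, 0)), Prod.ext rfl hb⟩

end Instances

end Summit.MatrixMultiplication.OmegaCensus
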